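import Summits.Ventures.PercRepro.Support
import Summits.Ventures.PercRepro.C012Induction

/-!
# "(BX) ⇒ C-012": the b-edge cross-term condition implies the row C-012

`BXgen` is the cross-term condition of `proofs/P5-C012.md` §7 in its re-marking-free form: for
every marked multigraph and every free edge `e` (`0 < p e < 1`) incident to a vertex `u` surely
connected to `b` (`P(b ~ u) = 1`; `u = b` is the b-edge case), the polarised slack between
`p[e:=0]` and `p[e:=1]` is at least `−min` of the two endpoint slacks.

* `sureConn_of_conn`: on the support, every vertex connected to `b` is surely connected to `b`
  once no free edge touches the sure cluster of `b` (induction along the open path).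
* `c012Slack_nonneg_of_noFree`: then `P(b ~ a), P(b ~ c) ∈ {0, 1}` and the slack is `0`.
* `C012_of_BXgen`: strong induction on the number of free edges — pick a free edge at the sure
  cluster of `b` and use `c012Slack_nonneg_of_bx` (quadratic interpolation + (BX)), or conclude
  by the degenerate case. Kernel-checked, standard axioms.

The mathematical content that is OPEN is `BXgen` itself (observed with room on 1,567 + 1,291
b-edges, `proofs/P5-C012.md` §7).
-/

namespace PercRepro

open Finset Classical

/-- **The condition (BX)** (general form): for every free edge `e` at the sure cluster of `b`,
`𝔅(L(p[e:=0]), L(p[e:=1])) ≥ −min(S(p[e:=0]), S(p[e:=1]))`. -/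
def BXgen : Prop :=
  ∀ {V E : Type} [Fintype E] [DecidableEq E] (G : MultiGraph V E) (p : E → ℝ), IsProb p →
    ∀ a b c : V, ∀ e : E, 0 < p e → p e < 1 →
      (prob p (G.connEvent b (G.fst e)) = 1 ∨ prob p (G.connEvent b (G.snd e)) = 1) →
      -min (c012Slack (G.law3 (Function.update p e 0) a b c))
          (c012Slack (G.law3 (Function.update p e 1) a b c)) ≤
        c012Bil (G.law3 (Function.update p e 0) a b c) (G.law3 (Function.update p e 1) a b c)

variable {E : Type*} [Fintype E] [DecidableEq E]

/-- The free edges of `p`: those with `p e ∉ {0, 1}`. -/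
noncomputable def freeSet (p : E → ℝ) : Finset E := univ.filter fun e => p e ≠ 0 ∧ p e ≠ 1

omit [DecidableEq E] in
/-- Membership in the free edge set: `p e ∉ {0, 1}`. -/
theorem mem_freeSet {p : E → ℝ} {e : E} : e ∈ freeSet p ↔ p e ≠ 0 ∧ p e ≠ 1 := by
  simp [freeSet]

/-- Fixing an edge to `0` or `1` removes it from the free set. -/
theorem freeSet_update {p : E → ℝ} (e : E) {x : ℝ} (hx : x = 0 ∨ x = 1) :
    freeSet (Function.update p e x) = (freeSet p).erase e := by
  ext f
  simp only [mem_freeSet, mem_erase]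
  by_cases hf : f = e
  · subst hf
    simp only [Function.update_self, ne_eq, not_true_eq_false, false_and, iff_false]
    rcases hx with h | h <;> simp [h]
  · rw [Function.update_of_ne hf]
    tauto

/-- A sure event contains the support of the weight. -/
theorem mem_of_prob_eq_one {p : E → ℝ} (hp : IsProb p) {A : Set (Config E)}
    (hA : prob p A = 1) {ω : Config E} (hω : weight p ω ≠ 0) : ω ∈ A := by
  by_contra hmem
  have h1 : prob p Aᶜ = 0 := by rw [prob_compl, hA]; ring
  have h2 : Aᶜ.indicator (weight p) ω ≤ prob p Aᶜ := by
    unfold prob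
    exact single_le_sum (fun ω' _ => Set.indicator_nonneg (fun ω' _ => weight_nonneg hp ω') ω')
      (mem_univ ω)
  rw [Set.indicator_of_mem (show ω ∈ Aᶜ from hmem), h1] at h2
  exact hω (le_antisymm h2 (weight_nonneg hp ω))

/-- `P(A) = 0` for a subevent of a null event. -/
theorem prob_eq_zero_of_subset {p : E → ℝ} (hp : IsProb p) {A B : Set (Config E)}
    (hAB : A ⊆ B) (hB : prob p B = 0) : prob p A = 0 :=
  le_antisymm (hB ▸ prob_mono hp hAB) (prob_nonneg hp A)

namespace MultiGraph

variable {V : Type*} (G : MultiGraph V E)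

/-- `b` is surely connected to itself. -/
theorem prob_connEvent_self (p : E → ℝ) (b : V) : prob p (G.connEvent b b) = 1 := by
  rw [connEvent_self, prob_univ]

/-- If no free edge touches the sure cluster of `b`, every vertex connected to `b` in a support
configuration is surely connected to `b`. -/
theorem sureConn_of_conn {p : E → ℝ} (hp : IsProb p) (b : V)
    (hnofree : ∀ e, (prob p (G.connEvent b (G.fst e)) = 1 ∨
      prob p (G.connEvent b (G.snd e)) = 1) → p e = 0 ∨ p e = 1)
    {ω : Config E} (hω : weight p ω ≠ 0) {u : V} (hu : G.Conn ω b u) :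
    prob p (G.connEvent b u) = 1 := by
  refine Conn.induction (motive := fun u => prob p (G.connEvent b u) = 1)
    (G.prob_connEvent_self p b) ?_ hu
  intro u w _ hadj hsure
  obtain ⟨e, he, hends⟩ := hadj
  -- the edge `e` touches the sure cluster, so it is deterministic, hence open with `p e = 1`
  have htouch : prob p (G.connEvent b (G.fst e)) = 1 ∨ prob p (G.connEvent b (G.snd e)) = 1 := by
    rcases hends with ⟨h1, _⟩ | ⟨_, h2⟩
    · exact Or.inl (h1 ▸ hsure)
    · exact Or.inr (h2 ▸ hsure)
  have hpe : p e = 1 := by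
    rcases hnofree e htouch with h0 | h1
    · exact absurd he (by rw [eq_false_of_weight_ne_zero_of_eq_zero hω h0]; decide)
    · exact h1
  apply prob_eq_one_of_forall_mem
  intro ω' hω'
  have hbu : ω' ∈ G.connEvent b u := mem_of_prob_eq_one hp hsure hω'
  have he' : ω' e = true := eq_true_of_weight_ne_zero_of_eq_one hω' hpe
  have hadj' : G.OpenAdj ω' u w := ⟨e, he', hends⟩
  exact ((mem_connEvent G).1 hbu).trans (Conn.of_openAdj hadj')

omit [Fintype E] [DecidableEq E] in
/-- `{a ~ c} ∩ {a ≁ b} ⊆ {b ≁ c}` (transitivity). -/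
theorem connEvent_ac_inter_sepEvent_ab_subset (a b c : V) :
    G.connEvent a c ∩ G.sepEvent a b ⊆ G.sepEvent b c := by
  intro ω hω
  simp only [Set.mem_inter_iff, mem_connEvent, mem_sepEvent] at hω ⊢
  exact fun hbc => hω.2 (hω.1.trans hbc.symm)

/-- A connection probability from `b` is `0` or `1` when no free edge touches the sure cluster. -/
theorem prob_connEvent_zero_or_one {p : E → ℝ} (hp : IsProb p) (b : V)
    (hnofree : ∀ e, (prob p (G.connEvent b (G.fst e)) = 1 ∨
      prob p (G.connEvent b (G.snd e)) = 1) → p e = 0 ∨ p e = 1) (u : V) :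
    prob p (G.connEvent b u) = 0 ∨ prob p (G.connEvent b u) = 1 := by
  by_cases h : prob p (G.connEvent b u) = 1
  · exact Or.inr h
  · left
    apply prob_eq_zero_of_forall_weight_eq_zero
    intro ω hω
    by_contra hw
    exact h (G.sureConn_of_conn hp b hnofree hw ((mem_connEvent G).1 hω))

/-- **Degenerate case**: if no free edge touches the sure cluster of `b`, the C-012 slack is `0`. -/
theorem c012Slack_nonneg_of_noFree {p : E → ℝ} (hp : IsProb p) (a b c : V)
    (hnofree : ∀ e, (prob p (G.connEvent b (G.fst e)) = 1 ∨
      prob p (G.connEvent b (G.snd e)) = 1) → p e = 0 ∨ p e = 1) :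
    0 ≤ c012Slack (G.law3 p a b c) := by
  rw [law3_eq_triLaw]
  have hx : G.triLaw p a b c 0 = prob p (G.connEvent a b ∩ G.connEvent b c) := rfl
  have hy₁ : G.triLaw p a b c 1 = prob p (G.connEvent a b ∩ G.sepEvent b c) := rfl
  have hy₂ : G.triLaw p a b c 2 = prob p (G.connEvent a c ∩ G.sepEvent a b) := rfl
  have hy₃ : G.triLaw p a b c 3 = prob p (G.connEvent b c ∩ G.sepEvent a b) := rfl
  have hz : G.triLaw p a b c 4 =
    prob p (G.sepEvent a b ∩ G.sepEvent b c ∩ G.sepEvent a c) := rfl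
  have hab := G.prob_connEvent_zero_or_one hp b hnofree a
  have hbc := G.prob_connEvent_zero_or_one hp b hnofree c
  rw [connEvent_comm] at hab
  unfold c012Slack
  rcases hab with hab | hab <;> rcases hbc with hbc | hbc
  · -- `a ≁ b`, `b ≁ c` surely: `x = y₁ = y₃ = 0`
    have h0 : G.triLaw p a b c 0 = 0 := by
      rw [hx]; exact prob_eq_zero_of_subset hp Set.inter_subset_left hab
    have h1 : G.triLaw p a b c 1 = 0 := by
      rw [hy₁]; exact prob_eq_zero_of_subset hp Set.inter_subset_left hab
    have h3 : G.triLaw p a b c 3 = 0 := by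
      rw [hy₃]; exact prob_eq_zero_of_subset hp Set.inter_subset_left hbc
    rw [h0, h1, h3]; ring_nf; exact le_refl _
  · -- `a ≁ b` surely, `b ~ c` surely: `x = y₁ = y₂ = z = 0`
    have hcomp : prob p (G.sepEvent b c) = 0 := by
      show prob p (G.connEvent b c)ᶜ = 0
      rw [prob_compl, hbc]; ring
    have h0 : G.triLaw p a b c 0 = 0 := by
      rw [hx]; exact prob_eq_zero_of_subset hp Set.inter_subset_left hab
    have h1 : G.triLaw p a b c 1 = 0 := by
      rw [hy₁]; exact prob_eq_zero_of_subset hp Set.inter_subset_left hab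
    have h2 : G.triLaw p a b c 2 = 0 := by
      rw [hy₂]
      exact prob_eq_zero_of_subset hp (G.connEvent_ac_inter_sepEvent_ab_subset a b c) hcomp
    have h4 : G.triLaw p a b c 4 = 0 := by
      rw [hz]
      exact prob_eq_zero_of_subset hp
        (Set.inter_subset_left.trans Set.inter_subset_right) hcomp
    rw [h0, h1, h2, h4]; ring_nf; exact le_refl _
  · -- `a ~ b` surely, `b ≁ c` surely: `y₂ = y₃ = z = 0` and `x = 0`
    have hcomp : prob p (G.sepEvent a b) = 0 := by
      show prob p (G.connEvent a b)ᶜ = 0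
      rw [prob_compl, hab]; ring
    have h0 : G.triLaw p a b c 0 = 0 := by
      rw [hx]; exact prob_eq_zero_of_subset hp Set.inter_subset_right hbc
    have h2 : G.triLaw p a b c 2 = 0 := by
      rw [hy₂]; exact prob_eq_zero_of_subset hp Set.inter_subset_right hcomp
    have h3 : G.triLaw p a b c 3 = 0 := by
      rw [hy₃]; exact prob_eq_zero_of_subset hp Set.inter_subset_right hcomp
    have h4 : G.triLaw p a b c 4 = 0 := by
      rw [hz]
      exact prob_eq_zero_of_subset hp
        (Set.inter_subset_left.trans Set.inter_subset_left) hcomp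
    rw [h0, h2, h3, h4]; ring_nf; exact le_refl _
  · -- both sure: `y₁ = y₂ = y₃ = z = 0`
    have hcab : prob p (G.sepEvent a b) = 0 := by
      show prob p (G.connEvent a b)ᶜ = 0
      rw [prob_compl, hab]; ring
    have hcbc : prob p (G.sepEvent b c) = 0 := by
      show prob p (G.connEvent b c)ᶜ = 0
      rw [prob_compl, hbc]; ring
    have h1 : G.triLaw p a b c 1 = 0 := by
      rw [hy₁]; exact prob_eq_zero_of_subset hp Set.inter_subset_right hcbc
    have h2 : G.triLaw p a b c 2 = 0 := by
      rw [hy₂]; exact prob_eq_zero_of_subset hp Set.inter_subset_right hcab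
    have h3 : G.triLaw p a b c 3 = 0 := by
      rw [hy₃]; exact prob_eq_zero_of_subset hp Set.inter_subset_right hcab
    have h4 : G.triLaw p a b c 4 = 0 := by
      rw [hz]
      exact prob_eq_zero_of_subset hp
        (Set.inter_subset_left.trans Set.inter_subset_left) hcab
    rw [h1, h2, h3, h4]; ring_nf; exact le_refl _

end MultiGraph

/-- **(BX) implies C-012**: strong induction on the number of free edges. -/
theorem C012_of_BXgen (hBX : BXgen) : C012 := by
  intro V E _ _ G p hp a b c
  rw [MultiGraph.c012_iff_slack_nonneg]
  suffices key : ∀ n : ℕ, ∀ p : E → ℝ, IsProb p → (freeSet p).card = n →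
      0 ≤ c012Slack (G.law3 p a b c) from key _ p hp rfl
  intro n
  induction n using Nat.strong_induction_on with
  | _ n ih =>
    intro p hp hcard
    by_cases hex : ∃ e ∈ freeSet p, prob p (G.connEvent b (G.fst e)) = 1 ∨
        prob p (G.connEvent b (G.snd e)) = 1
    · obtain ⟨e, he, htouch⟩ := hex
      have hfree := mem_freeSet.1 he
      have hpe0 : 0 < p e := lt_of_le_of_ne (hp e).1 (Ne.symm hfree.1)
      have hpe1 : p e < 1 := lt_of_le_of_ne (hp e).2 hfree.2
      have hn : 0 < n := hcard ▸ card_pos.2 ⟨e, he⟩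
      have hcard' : ∀ x : ℝ, x = 0 ∨ x = 1 →
          (freeSet (Function.update p e x)).card = n - 1 := by
        intro x hx
        rw [freeSet_update e hx, card_erase_of_mem he, hcard]
      have h0 := ih (n - 1) (Nat.sub_lt hn Nat.one_pos) (Function.update p e 0)
        (hp.update e ⟨le_rfl, zero_le_one⟩) (hcard' 0 (Or.inl rfl))
      have h1 := ih (n - 1) (Nat.sub_lt hn Nat.one_pos) (Function.update p e 1)
        (hp.update e ⟨zero_le_one, le_rfl⟩) (hcard' 1 (Or.inr rfl))
      exact G.c012Slack_nonneg_of_bx hp e a b c h0 h1 (hBX G p hp a b c e hpe0 hpe1 htouch)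
    · apply G.c012Slack_nonneg_of_noFree hp a b c
      intro e htouch
      by_contra hcon
      exact hex ⟨e, mem_freeSet.2 (not_or.1 hcon), htouch⟩

end PercRepro
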